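import Summits.FinalStateConjecture.FinalStateConjecture.Theorems.ParametricKerrBurial.Negative.GeneralSpinShieldTeeth
import Summits.FinalStateConjecture.FinalStateConjecture.Theorems.ParametricKerrBurial.Negative.ZeroSpinBurialLimit

/-!
# Negative lemmas for the crux `SwallowTheDatum.ParametricKerrBurial`, V — ALL-SPIN swell-or-recede:
# the `c → 0` limit for the full shielding predicate

Support file (refuter, cdisprove seat of `stmt-FinalStateConjecture-10052`, cycle 3; everything
proved, no definitions, no named facts), continuing `GeneralSpinShieldTeeth.lean` (IV) and
`ZeroSpinBurialLimit.lean` (II). Part II used the INTRINSIC zero-spin tooth `R > 0`; for general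
spin we use the EXTRINSIC axis tooth of part IV together with the `h`-clause at the same point:
at `x = φ(0, 0, 3M)`, `v = dφ e_z`,

* `h_pullback_axisPt`, `Hax_three_mul_le` — `h(v, v) = g(∂_z, ∂_z) = 1 + 2H ≤ 5/3`;
* `axisTooth_ge` — `k(v, v) ≥ 4/(25M)` UNIFORMLY in the spin (`neg_dHax_three_mul_ge`:
  `63M⁴ − 61M²a² − 2a⁴ = (M² − a²)(63M² + 2a²) ≥ 0`);
* `contDiffAt_kRepr_of_isSmoothDataFamily` — along a smooth family the `k`-sections, like the
  `h`-sections (part II), are jointly `C^∞` in `(c, y)`; `continuous_eval₂`;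
* `not_confined_burial_of_mass_le` — **the CONFINED BOUNDED-MASS strengthening of the crux is
  false for the full predicate and every time-symmetric centre**: along `cₙ → 0` the members of a
  smooth family through a time-symmetric datum on `ℝ³` (flat data, Brill waves) cannot carry Kerr
  shields of ANY spin with `Mₙ ≤ μ` whose near-junction zones stay in one compact set. The
  junction spheres of a burial family must swell or recede to infinity — the typed genericity
  (`IsSmoothDataFamily` = local joint smoothness on `ℝ¹ × X`) is escaped only where it carries no
  topology (route kill criterion (e), quantified; supersedes the zero-spin
  `not_confined_zeroSpin_burial_of_radius_le`).

References: D. Christodoulou, CQG 16 (1999) A23, p. A24 (families of data) [Christodoulou1999];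
G. B. Cook, Living Rev. Relativ. 3 (2000) 5, §3.2.2 (55)–(57) [Cook2000].
-/

noncomputable section

-- instance search through nested operator types `E4 →L E4 →L E4 →L ℝ` (as in the tree files)
set_option maxSynthPendingDepth 3
-- `Summit.<S>.<S>.…` by design (D-0017; the Summits lakefile turns this linter off as well)
set_option linter.dupNamespace false

namespace Summit.FinalStateConjecture.FinalStateConjecture.Theorems.ParametricKerrBurial.Negative

open Literature.Geometry.Lorentzian
open scoped Manifold ContDiff Topology InnerProductSpace
open Set Filter

/-- The spatial unit vector `e_z ∈ E3` (local notation). -/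
local notation "e_z" => (EuclideanSpace.single (2 : Fin 3) (1 : ℝ) : E3)

/-- The constant axis covector `ℓ₀ = dt* + dz` (local notation). -/
local notation "ℓ₀" => (E4.covector ![(1 : ℝ), 0, 0, 1])

/-! ### `h` at the axis test point and the spin-uniform size of the tooth -/

/-- **`h` of a Kerr-shielded datum at the axis test point (any spin)**:
`h_{φ y₀}(dφ e_z, dφ e_z) = g(∂_z, ∂_z) = 1 + 2H_ax(3M)`. [cite: Cook2000, §3.2.2 (55)] -/
theorem h_pullback_axisPt [Kerr.Facts] {X : Type*} [TopologicalSpace X] [ChartedSpace E3 X]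
    [IsManifold (𝓡 3) ∞ X] (D : InitialDataSet (𝓡 3) X) {M a r₁ : ℝ} (hM : 0 ≤ M)
    (haM : |a| < M) (hr₁ : r₁ < Kerr.rPlus M a) {T : ℝ → ℝ} (hT0 : ∀ r, r ≤ 4 * M → T r = 0)
    {φ : Kerr.slice a r₁ → X} {ψ : Kerr.slice a r₁ → Kerr.region a r₁}
    (hψ : ∀ y : Kerr.slice a r₁, (ψ y : E4) =
      E4.ofTimeSpace (T (Kerr.radius a (E4.ofTimeSpace 0 (y : E3)))) (y : E3))
    (hh : ∀ y : Kerr.slice a r₁,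
      pullbackBilin (I := 𝓡 3) (I' := 𝓘(ℝ, E3)) φ D.h.inner y =
        pullbackBilin (I := 𝓘(ℝ, E4)) (I' := 𝓘(ℝ, E3)) ψ (Kerr.smoothMetric M a r₁).val y) :
    D.h.inner (φ ⟨(3 * M) • e_z, axisPt_mem_slice hM haM hr₁⟩)
        (mfderiv 𝓘(ℝ, E3) (𝓡 3) φ ⟨(3 * M) • e_z, axisPt_mem_slice hM haM hr₁⟩ e_z)
        (mfderiv 𝓘(ℝ, E3) (𝓡 3) φ ⟨(3 * M) • e_z, axisPt_mem_slice hM haM hr₁⟩ e_z) =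
      1 + 2 * (M * (3 * M) / ((3 * M) ^ 2 + a ^ 2)) := by
  have hMpos : 0 < M := (abs_nonneg a).trans_lt haM
  have h3M : (0 : ℝ) < 3 * M := by positivity
  set y : Kerr.slice a r₁ := ⟨(3 * M) • e_z, axisPt_mem_slice hM haM hr₁⟩ with hydef
  have hyE : (y : E3) = (3 * M) • e_z := rfl
  have hy4 : Kerr.radius a (E4.ofTimeSpace 0 (y : E3)) < 4 * M := by
    rw [hyE, radius_axisPt a 0 h3M]; linarith
  have e : D.h.inner (φ y) (mfderiv 𝓘(ℝ, E3) (𝓡 3) φ y e_z) (mfderiv 𝓘(ℝ, E3) (𝓡 3) φ y e_z) =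
      (Kerr.smoothMetric M a r₁).val (ψ y) (mfderiv 𝓘(ℝ, E3) 𝓘(ℝ, E4) ψ y e_z)
        (mfderiv 𝓘(ℝ, E3) 𝓘(ℝ, E4) ψ y e_z) :=
    DFunLike.congr_fun (DFunLike.congr_fun (hh y) e_z) e_z
  rw [e, spin_mfderiv_psi hT0 hψ hy4, Kerr.smoothMetric_val, spin_psi_eq_sliceEmbed hT0 hψ hy4,
    Kerr.coe_sliceEmbed]
  show Kerr.bilin M a (E4.ofTimeSpace 0 (y : E3)) (E4.ofTimeSpace 0 e_z) (E4.ofTimeSpace 0 e_z) =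
    1 + 2 * (M * (3 * M) / ((3 * M) ^ 2 + a ^ 2))
  rw [hyE, ofTimeSpace_ez, bilin_axisPt M a 0 h3M]
  have hη : Minkowski.bilin (E4.basisVector 3) (E4.basisVector 3) = 1 := by
    rw [Kerr.minkowski_bilin_basisVector]
    simp [Kerr.etaComp, show ((3 : Fin 4) = 0) = False by decide]
  simp only [_root_.add_apply, FunLike.coe_smul, Pi.smul_apply, smul_eq_mul, E4.tmul_apply,
    ell0_basisVector_three, hη]
  ring

/-- `H_ax(3M) ≤ 1/3`, so `h(dφ e_z, dφ e_z) = 1 + 2H ≤ 5/3` at the tooth. [folklore] -/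
theorem Hax_three_mul_le {M a : ℝ} (hM : 0 < M) : M * (3 * M) / ((3 * M) ^ 2 + a ^ 2) ≤ 1 / 3 := by
  rw [div_le_div_iff₀ (by positivity) (by norm_num)]
  nlinarith [sq_nonneg a]

/-- Spin-uniform size of the axis tooth: `−H_ax′(3M) ≥ 2/(25M)` for `|a| < M`
(`63M⁴ − 61M²a² − 2a⁴ = (M² − a²)(63M² + 2a²) ≥ 0`). [folklore] -/
theorem neg_dHax_three_mul_ge {M a : ℝ} (haM : |a| < M) :
    2 / (25 * M) ≤ -(M * (a ^ 2 - (3 * M) ^ 2) / ((3 * M) ^ 2 + a ^ 2) ^ 2) := by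
  have hM : 0 < M := (abs_nonneg a).trans_lt haM
  have ha : a ^ 2 < M ^ 2 := sq_lt_sq' (abs_lt.1 haM).1 (abs_lt.1 haM).2
  rw [← neg_div, neg_mul_eq_mul_neg, neg_sub, div_le_div_iff₀ (by positivity) (by positivity)]
  have key : 0 ≤ (M ^ 2 - a ^ 2) * (63 * M ^ 2 + 2 * a ^ 2) :=
    mul_nonneg (by linarith) (by positivity)
  nlinarith [key]

/-- **The tooth is uniformly large for bounded mass**: `tooth ≥ 4/(25M)`. [folklore] -/
theorem axisTooth_ge {M a : ℝ} (haM : |a| < M) :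
    4 / (25 * M) ≤ -2 * (√(1 + 2 * (M * (3 * M) / ((3 * M) ^ 2 + a ^ 2))))⁻¹ *
      (M * (a ^ 2 - (3 * M) ^ 2) / ((3 * M) ^ 2 + a ^ 2) ^ 2) *
      (1 + M * (3 * M) / ((3 * M) ^ 2 + a ^ 2)) := by
  have hM : 0 < M := (abs_nonneg a).trans_lt haM
  set H := M * (3 * M) / ((3 * M) ^ 2 + a ^ 2) with hH
  have hH0 : 0 ≤ H := by rw [hH]; positivity
  set s := √(1 + 2 * H) with hs
  have hs0 : 0 < s := Real.sqrt_pos.2 (by positivity)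
  have hsle : s ≤ 1 + H := by
    rw [hs, show (1 : ℝ) + H = √((1 + H) ^ 2) by rw [Real.sqrt_sq (by positivity)]]
    exact Real.sqrt_le_sqrt (by nlinarith)
  have h1 : 1 ≤ s⁻¹ * (1 + H) := by
    calc (1 : ℝ) = s⁻¹ * s := (inv_mul_cancel₀ hs0.ne').symm
      _ ≤ s⁻¹ * (1 + H) := mul_le_mul_of_nonneg_left hsle (inv_pos.2 hs0).le
  have h2 := neg_dHax_three_mul_ge haM
  have h3 : 0 ≤ 2 / (25 * M) := by positivity
  calc 4 / (25 * M) = 2 * 1 * (2 / (25 * M)) := by ring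
    _ ≤ 2 * (s⁻¹ * (1 + H)) * (-(M * (a ^ 2 - (3 * M) ^ 2) / ((3 * M) ^ 2 + a ^ 2) ^ 2)) :=
        mul_le_mul (mul_le_mul_of_nonneg_left h1 (by norm_num)) h2 h3 (by positivity)
    _ = _ := by ring

/-! ### Joint continuity of the `k`-sections of a smooth family -/

/-- **Bridge from bundle smoothness to calculus, `k`-part** (the `h`-part is
`contDiffAt_repr_of_isSmoothDataFamily` of part II): along a smooth family of data on a chart
domain `U ⊆ E3`, any representative `K c` of `k_c` is jointly `C^∞` in `(c, y)`.
[cite: Christodoulou1999, p. A24] -/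
theorem contDiffAt_kRepr_of_isSmoothDataFamily {U : TopologicalSpace.Opens E3}
    {F : EuclideanSpace ℝ (Fin 1) → InitialDataSet 𝓘(ℝ, E3) U}
    (hF : InitialDataSet.IsSmoothDataFamily 1 F)
    {K : EuclideanSpace ℝ (Fin 1) → E3 → E3 →L[ℝ] E3 →L[ℝ] ℝ} (hK : ∀ c (y : U), (F c).k y = K c y)
    (c₀ : EuclideanSpace ℝ (Fin 1)) (y₀ : U) :
    ContDiffAt ℝ ∞ (Function.uncurry K) (c₀, (y₀ : E3)) := by
  classical
  have h1 := hF.2 (c₀, y₀)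
  rw [contMDiffAt_bilin_iff] at h1
  obtain ⟨-, h2⟩ := h1
  have hsymm : ∀ (z : U) (v : E3),
      (trivializationAt E3 (TangentSpace 𝓘(ℝ, E3) : U → Type _) y₀).symmL ℝ z v = v := by
    intro z v
    rw [Bundle.Trivialization.symmL_apply _ (by simp [OpensChart.chartAt_source])]
    exact OpensChart.trivializationAt_symm_apply y₀ z v
  have hfun : (fun x : EuclideanSpace ℝ (Fin 1) × U ↦ (ContinuousLinearMap.precomp ℝ
      ((trivializationAt E3 (TangentSpace 𝓘(ℝ, E3) : U → Type _) y₀).symmL ℝ x.2)).comp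
        (((F x.1).k x.2).comp
          ((trivializationAt E3 (TangentSpace 𝓘(ℝ, E3) : U → Type _) y₀).symmL ℝ x.2))) =
      fun x ↦ K x.1 x.2 := by
    funext x
    ext v w
    simp only [ContinuousLinearMap.comp_apply, ContinuousLinearMap.precomp_apply, hsymm, hK]
    rfl
  rw [hfun] at h2
  set σ : E3 → U := fun z ↦ if hz : z ∈ U then ⟨z, hz⟩ else y₀ with hσdef
  have hσval : ∀ z ∈ (U : Set E3), (σ z : E3) = z := fun z hz ↦ by
    have hz' : z ∈ U := hz
    simp only [hσdef]
    rw [dif_pos hz']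
  have hσy₀ : σ y₀ = y₀ := by
    simp only [hσdef]
    rw [dif_pos y₀.2]
  have hUo : IsOpen ((Set.univ : Set (EuclideanSpace ℝ (Fin 1))) ×ˢ (U : Set E3)) :=
    isOpen_univ.prod U.2
  have hmem : (c₀, (y₀ : E3)) ∈ (Set.univ : Set (EuclideanSpace ℝ (Fin 1))) ×ˢ (U : Set E3) :=
    ⟨trivial, y₀.2⟩
  have hj2 : ContMDiffAt 𝓘(ℝ, EuclideanSpace ℝ (Fin 1) × E3) 𝓘(ℝ, E3) ∞
      (fun q : EuclideanSpace ℝ (Fin 1) × E3 ↦ σ q.2) (c₀, (y₀ : E3)) := by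
    rw [← ContMDiffAt.subtypeVal_comp_iff]
    have hev : (Subtype.val ∘ fun q : EuclideanSpace ℝ (Fin 1) × E3 ↦ σ q.2) =ᶠ[𝓝 (c₀, (y₀ : E3))]
        Prod.snd := by
      filter_upwards [hUo.mem_nhds hmem] with q hq
      exact hσval q.2 hq.2
    exact contDiff_snd.contMDiff.contMDiffAt.congr_of_eventuallyEq hev
  have hj : ContMDiffAt 𝓘(ℝ, EuclideanSpace ℝ (Fin 1) × E3)
      (𝓘(ℝ, EuclideanSpace ℝ (Fin 1)).prod 𝓘(ℝ, E3)) ∞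
      (fun q : EuclideanSpace ℝ (Fin 1) × E3 ↦ (q.1, σ q.2)) (c₀, (y₀ : E3)) :=
    contDiff_fst.contMDiff.contMDiffAt.prodMk hj2
  have hcomp : ContMDiffAt 𝓘(ℝ, EuclideanSpace ℝ (Fin 1) × E3) 𝓘(ℝ, E3 →L[ℝ] E3 →L[ℝ] ℝ) ∞
      ((fun x : EuclideanSpace ℝ (Fin 1) × U ↦ K x.1 x.2) ∘
        fun q : EuclideanSpace ℝ (Fin 1) × E3 ↦ (q.1, σ q.2)) (c₀, (y₀ : E3)) :=
    ContMDiffAt.comp_of_eq h2 hj (Prod.ext rfl hσy₀)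
  have hev2 : Function.uncurry K =ᶠ[𝓝 (c₀, (y₀ : E3))]
      ((fun x : EuclideanSpace ℝ (Fin 1) × U ↦ K x.1 x.2) ∘
        fun q : EuclideanSpace ℝ (Fin 1) × E3 ↦ (q.1, σ q.2)) := by
    filter_upwards [hUo.mem_nhds hmem] with q hq
    simp only [Function.comp_apply, Function.uncurry, hσval q.2 hq.2]
  exact contMDiffAt_iff_contDiffAt.1 (hcomp.congr_of_eventuallyEq hev2)

/-- The evaluation `(B, u) ↦ B u u` is continuous. [folklore] -/
theorem continuous_eval₂ :
    Continuous fun p : (E3 →L[ℝ] E3 →L[ℝ] ℝ) × E3 ↦ p.1 p.2 p.2 :=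
  (continuous_fst.clm_apply continuous_snd).clm_apply continuous_snd

/-! ### ALL-SPIN swell-or-recede -/

set_option maxHeartbeats 400000 in
/-- **ALL-SPIN swell-or-recede** (the confined bounded-mass strengthening of the crux
`ParametricKerrBurial` refuted at every TIME-SYMMETRIC centre). Let `F` be a smooth one-parameter
family of data on `ℝ³` whose member `F 0` is time-symmetric (`k ≡ 0`: flat data, Brill waves, …),
let `cₙ → 0`, and suppose each `F cₙ` carries a Kerr shield of ANY spin `|aₙ| < Mₙ` — junction
radius `r₁(n) < r₊`, a height `Tₙ ≡ 0` on `r ≤ 4Mₙ`, a smooth `φₙ`, the graph `ψₙ` of `Tₙ` with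
future unit normal `νₙ`, `φₙ^* h = ψₙ^* g`, `φₙ^* k = K_{νₙ}(ψₙ)` — of mass `Mₙ ≤ μ`, whose
near-junction zone `φₙ({r < 4Mₙ})` lies in ONE compact set `C`. Then `False`: the axis teeth
`k(vₙ, vₙ) ≥ 4/(25μ)` with `h(vₙ, vₙ) ≤ 5/3` at points of `C` contradict the joint continuity of
`(c, x) ↦ (h, k)` at `c = 0`, where `k ≡ 0` (normalise `vₙ`, extract subsequences in `C` and in
the unit sphere, pass to the limit in `ρ h(u, u) ≤ k(u, u)`). So the horizons of a burial family
through a time-symmetric datum must SWELL (`Mₙ → ∞`) or RECEDE to infinity: the typed genericity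
is escaped only where it has no topology. [cite: Christodoulou1999, p. A24] [cite: Cook2000, §3.2.2 (57)] -/
theorem not_confined_burial_of_mass_le [Kerr.Facts]
    {F : EuclideanSpace ℝ (Fin 1) → InitialDataSet (𝓡 3) Minkowski.slice}
    (hF : InitialDataSet.IsSmoothDataFamily 1 F) (h0 : (F 0).IsTimeSymmetric)
    {c : ℕ → EuclideanSpace ℝ (Fin 1)} (hc : Tendsto c atTop (𝓝 0)) {M a r₁ : ℕ → ℝ}
    {C : Set Minkowski.slice} (hC : IsCompact C) {μ : ℝ} (hμ : ∀ n, M n ≤ μ)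
    (hS : ∀ n, ∃ (hM : 0 ≤ M n) (T : ℝ → ℝ) (φ : Kerr.slice (a n) (r₁ n) → Minkowski.slice)
      (ψ : Kerr.slice (a n) (r₁ n) → Kerr.region (a n) (r₁ n)) (ν : NormalField 𝓘(ℝ, E4) ψ),
      |a n| < M n ∧ r₁ n < Kerr.rPlus (M n) (a n) ∧ (∀ r, r ≤ 4 * M n → T r = 0) ∧
      (∀ y : Kerr.slice (a n) (r₁ n), (ψ y : E4) =
        E4.ofTimeSpace (T (Kerr.radius (a n) (E4.ofTimeSpace 0 (y : E3)))) (y : E3)) ∧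
      (Kerr.smoothMetric (M n) (a n) (r₁ n)).IsFutureUnitNormal 𝓘(ℝ, E3)
        ((Kerr.timeOrientation (M n) (a n) (r₁ n) hM).ofLE le_top) ψ ν ∧
      (∀ y : Kerr.slice (a n) (r₁ n),
        pullbackBilin (I := 𝓡 3) (I' := 𝓘(ℝ, E3)) φ (F (c n)).h.inner y =
          pullbackBilin (I := 𝓘(ℝ, E4)) (I' := 𝓘(ℝ, E3)) ψ
            (Kerr.smoothMetric (M n) (a n) (r₁ n)).val y) ∧
      (∀ [(Kerr.smoothMetric (M n) (a n) (r₁ n)).HasLeviCivita] (y : Kerr.slice (a n) (r₁ n)),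
        (pullbackBilin (I := 𝓡 3) (I' := 𝓘(ℝ, E3)) φ (F (c n)).k y).toLinearMap₁₂ =
          (Kerr.smoothMetric (M n) (a n) (r₁ n)).secondFundamentalForm 𝓘(ℝ, E3) ψ ν y) ∧
      (∀ y : Kerr.slice (a n) (r₁ n),
        Kerr.radius (a n) (E4.ofTimeSpace 0 (y : E3)) < 4 * M n → φ y ∈ C)) : False := by
  -- the teeth
  have hMpos : ∀ n, 0 < M n := fun n ↦ by
    obtain ⟨hM, T, φ, ψ, ν, haM, -⟩ := hS n
    exact (abs_nonneg (a n)).trans_lt haM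
  have hμpos : 0 < μ := (hMpos 0).trans_le (hμ 0)
  have hn : ∀ n, ∃ x ∈ C, ∃ v : E3,
      (F (c n)).h.inner x v v ≤ 5 / 3 ∧ 4 / (25 * μ) ≤ (F (c n)).k x v v := by
    intro n
    obtain ⟨hM, T, φ, ψ, ν, haM, hr₁, hT0, hψ, hν, hh, hk, hCφ⟩ := hS n
    have h3M : (0 : ℝ) < 3 * M n := by have := hMpos n; positivity
    set y₀ : Kerr.slice (a n) (r₁ n) := ⟨(3 * M n) • e_z, axisPt_mem_slice hM haM hr₁⟩ with hy₀
    have hy4 : Kerr.radius (a n) (E4.ofTimeSpace 0 (y₀ : E3)) < 4 * M n := by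
      show Kerr.radius (a n) (E4.ofTimeSpace 0 ((3 * M n) • e_z)) < 4 * M n
      rw [radius_axisPt (a n) 0 h3M]; linarith
    refine ⟨φ y₀, hCφ y₀ hy4, mfderiv 𝓘(ℝ, E3) (𝓡 3) φ y₀ e_z, ?_, ?_⟩
    · rw [h_pullback_axisPt (F (c n)) hM haM hr₁ hT0 hψ hh]
      have := Hax_three_mul_le (a := a n) (hMpos n)
      linarith
    · rw [k_pullback_axisPt (F (c n)) hM haM hr₁ hT0 hψ hν hk]
      refine le_trans ?_ (axisTooth_ge haM)
      exact div_le_div_of_nonneg_left (by norm_num) (by have := hMpos n; positivity)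
        (by nlinarith [hμ n])
  choose x hxC v hv1 hv2 using hn
  -- representatives, jointly continuous
  set G : EuclideanSpace ℝ (Fin 1) → E3 → E3 →L[ℝ] E3 →L[ℝ] ℝ :=
    fun c z ↦ (F c).h.inner ⟨z, Minkowski.mem_slice z⟩ with hGdef
  set K : EuclideanSpace ℝ (Fin 1) → E3 → E3 →L[ℝ] E3 →L[ℝ] ℝ :=
    fun c z ↦ (F c).k ⟨z, Minkowski.mem_slice z⟩ with hKdef
  have hGc : ∀ q : EuclideanSpace ℝ (Fin 1) × E3, ContinuousAt (Function.uncurry G) q := fun q ↦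
    (contDiffAt_repr_of_isSmoothDataFamily hF (G := G) (fun c y ↦ rfl) q.1
      ⟨q.2, Minkowski.mem_slice q.2⟩).continuousAt
  have hKc : ∀ q : EuclideanSpace ℝ (Fin 1) × E3, ContinuousAt (Function.uncurry K) q := fun q ↦
    (contDiffAt_kRepr_of_isSmoothDataFamily hF (K := K) (fun c y ↦ rfl) q.1
      ⟨q.2, Minkowski.mem_slice q.2⟩).continuousAt
  -- normalise the tooth vectors
  have hvne : ∀ n, v n ≠ 0 := fun n h ↦ by
    have h2 := hv2 n
    have hz1 : (F (c n)).k (x n) (v n) = 0 := by rw [h]; exact map_zero _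
    have hz : (F (c n)).k (x n) (v n) (v n) = 0 := by rw [hz1]; rfl
    have : (0:ℝ) < 4 / (25 * μ) := by positivity
    linarith
  set u : ℕ → E3 := fun n ↦ ‖v n‖⁻¹ • v n with hudef
  have hu1 : ∀ n, ‖u n‖ = 1 := fun n ↦ by
    rw [hudef]
    simp only [norm_smul, norm_inv, norm_norm]
    exact inv_mul_cancel₀ (norm_ne_zero_iff.2 (hvne n))
  have hscale : ∀ n (B : E3 →L[ℝ] E3 →L[ℝ] ℝ), B (u n) (u n) = (‖v n‖ ^ 2)⁻¹ * B (v n) (v n) := by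
    intro n B
    simp only [hudef, map_smul, FunLike.coe_smul, Pi.smul_apply, smul_eq_mul]
    ring
  -- ratio bound: k(u,u) ≥ ρ h(u,u), ρ = (4/(25μ))/(5/3)
  set ρ : ℝ := 4 / (25 * μ) / (5 / 3) with hρ
  have hρpos : 0 < ρ := by positivity
  have hratio : ∀ n, ρ * G (c n) (x n) (u n) (u n) ≤ K (c n) (x n) (u n) (u n) := by
    intro n
    have hG' : G (c n) (x n) = (F (c n)).h.inner (x n) := rfl
    have hK' : K (c n) (x n) = (F (c n)).k (x n) := rfl
    rw [hscale n, hscale n, hG', hK']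
    have hp : 0 < (‖v n‖ ^ 2)⁻¹ := by
      have := norm_pos_iff.2 (hvne n); positivity
    have h3 : ρ * (F (c n)).h.inner (x n) (v n) (v n) ≤ (F (c n)).k (x n) (v n) (v n) := by
      calc ρ * (F (c n)).h.inner (x n) (v n) (v n) ≤ ρ * (5 / 3) :=
            mul_le_mul_of_nonneg_left (hv1 n) hρpos.le
        _ = 4 / (25 * μ) := by rw [hρ]; field_simp
        _ ≤ _ := hv2 n
    calc ρ * ((‖v n‖ ^ 2)⁻¹ * (F (c n)).h.inner (x n) (v n) (v n))
        = (‖v n‖ ^ 2)⁻¹ * (ρ * (F (c n)).h.inner (x n) (v n) (v n)) := by ring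
      _ ≤ (‖v n‖ ^ 2)⁻¹ * (F (c n)).k (x n) (v n) (v n) := mul_le_mul_of_nonneg_left h3 hp.le
  -- subsequences: xₙ → x*, then uₙ → u*
  obtain ⟨xs, hxs, κ, hκ, hlimx⟩ := hC.tendsto_subseq hxC
  have husph : ∀ n, u (κ n) ∈ Metric.sphere (0 : E3) 1 := fun n ↦ by
    rw [Metric.mem_sphere, dist_zero_right]; exact hu1 _
  obtain ⟨us, hus, κ', hκ', hlimu⟩ := (isCompact_sphere (0 : E3) 1).tendsto_subseq husph
  have hus1 : ‖us‖ = 1 := by rwa [Metric.mem_sphere, dist_zero_right] at hus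
  have husne : us ≠ 0 := fun h ↦ by rw [h, norm_zero] at hus1; exact zero_ne_one hus1
  -- the limits
  have hcκ : Tendsto (fun n ↦ c (κ (κ' n))) atTop (𝓝 0) :=
    hc.comp (hκ.tendsto_atTop.comp hκ'.tendsto_atTop)
  have hxκ : Tendsto (fun n ↦ ((x (κ (κ' n)) : E3))) atTop (𝓝 (xs : E3)) :=
    ((continuous_subtype_val.tendsto xs).comp hlimx).comp hκ'.tendsto_atTop
  have hq : Tendsto (fun n ↦ (c (κ (κ' n)), (x (κ (κ' n)) : E3))) atTop (𝓝 (0, (xs : E3))) :=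
    hcκ.prodMk_nhds hxκ
  have hGlim : Tendsto (fun n ↦ G (c (κ (κ' n))) (x (κ (κ' n)))) atTop (𝓝 (G 0 xs)) :=
    ((hGc (0, (xs : E3))).tendsto).comp hq
  have hKlim : Tendsto (fun n ↦ K (c (κ (κ' n))) (x (κ (κ' n)))) atTop (𝓝 (K 0 xs)) :=
    ((hKc (0, (xs : E3))).tendsto).comp hq
  have hGev : Tendsto (fun n ↦ G (c (κ (κ' n))) (x (κ (κ' n))) (u (κ (κ' n))) (u (κ (κ' n))))
      atTop (𝓝 (G 0 xs us us)) :=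
    (continuous_eval₂.tendsto (G 0 xs, us)).comp (hGlim.prodMk_nhds hlimu)
  have hKev : Tendsto (fun n ↦ K (c (κ (κ' n))) (x (κ (κ' n))) (u (κ (κ' n))) (u (κ (κ' n))))
      atTop (𝓝 (K 0 xs us us)) :=
    (continuous_eval₂.tendsto (K 0 xs, us)).comp (hKlim.prodMk_nhds hlimu)
  have hK0 : K 0 xs us us = 0 := by
    have : K 0 xs = 0 := h0 ⟨xs, Minkowski.mem_slice xs⟩
    rw [this]; rfl
  have hG0 : 0 < G 0 xs us us := (F 0).h.pos ⟨xs, Minkowski.mem_slice xs⟩ us husne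
  -- pass to the limit in `ρ G(u,u) ≤ K(u,u)`
  have hle : ρ * G 0 xs us us ≤ K 0 xs us us :=
    le_of_tendsto_of_tendsto (hGev.const_mul ρ) hKev (Eventually.of_forall fun n ↦ hratio _)
  rw [hK0] at hle
  nlinarith [hle, hG0, hρpos]

end Summit.FinalStateConjecture.FinalStateConjecture.Theorems.ParametricKerrBurial.Negative

end
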